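import Summits.QuantumFields.YangMills.Theorems.ColdStartUniversalityLatticeLangevinBakryEmeryPoincareFlow
import Mathlib.Analysis.SpecialFunctions.Log.Deriv
import HarnessLib

/-!
# Route `ColdStartUniversality` (fixed-cut-off package, Bakry–Émery side, log-Sobolev half): ENTROPY AND FISHER INFORMATION
# ALONG THE SZZ SEMIGROUP — the time-derivatives (de Bruijn's identity and the derivative of the Fisher information)

Helper file (seat `ym-line-csu-p1`, g26; `--supports stmt-QuantumFields-24809`).  For the SU(2) lattice Langevin dynamics of
Shen–Zhu–Zhu on `(ℤ/L)³` at a FIXED cut-off and coupling `β'`, `μ = μ_(β')`, `𝓛 = 𝓛_(β')` the coordinate generator, `κ_t` any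
realising Markov kernel family, `Q = q∘coords` a `C³` compactly supported cylinder function:
* ★ `transition_cylinder_toolkit` — the standing facts on `P_τQ(x) = κ_τQ(x)` and `κ_τ(𝓛q)(x)`: bounds, continuity in `x` and in `τ`,
  `∂_τ κ_τQ(x) = κ_τ(𝓛q)(x)` (`τ > 0`, Dynkin), invariance `∫ κ_τQ dμ = ∫ Q dμ`, `∫ κ_τ(𝓛q) dμ = 0`; ★ `le_transition_of_le` (positivity);
* ★★ `entropy_transition_hasDerivAt` (DE BRUIJN) — for positive `Q`: `τ ↦ ∫ κ_τQ log κ_τQ dμ` is continuous and, for `τ > 0`, has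
  derivative `∫ κ_τ(𝓛q)·log κ_τQ dμ` (`= −I(τ)`, minus the Fisher information, by symmetry);
* ★★ `fisher_transition_hasDerivAt` — given a `C³` compactly supported ambient representative `G` of `𝓛q` (`G∘coords = 𝓛q`):
  `τ ↦ ∫ κ_τ(𝓛q)·log κ_τQ dμ` is continuous and, for `τ > 0`, has derivative `∫ (κ_τ(𝓛G)·log κ_τQ + (κ_τ𝓛q)²/κ_τQ) dμ`.
Fixed-cut-off semigroup calculus (BGL 2014 §5.7, proof of Prop. 5.7.3).  THEOREMS ONLY, no definition, no sorry.  HONEST FRAMING: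
nothing K-uniform; no crux, rung or summit statement is proved; the Yang–Mills mass gap is NOT proved.
-/

set_option autoImplicit false

noncomputable section

namespace Summit.QuantumFields.YangMills.Theorems.ColdStartUniversality

open MeasureTheory ProbabilityTheory Finset Filter Set
open scoped BigOperators NNReal ENNReal Topology
open Literature.Probability.Process Literature.MathematicalPhysics.QuantumFieldTheory
open Literature.MathematicalPhysics.QuantumLattice (fundamentalRep fundamentalLatticeRep continuous_fundamentalRep)

variable {L : ℕ} [NeZero L]

/-! ## §1. Toolkit -/

/-- ★ **Standing facts on `κ_τQ` and `κ_τ(𝓛q)` for a `C³` compactly supported cylinder function** (any realising kernel family):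
a common bound, continuity in the start and in time, the Dynkin derivative `∂_τ κ_τQ(x) = κ_τ(𝓛q)(x)` for `τ > 0`, the invariance
`∫ κ_τQ dμ_(β') = ∫ Q dμ_(β')` and `∫ κ_τ(𝓛q) dμ_(β') = 0`. [folklore] -/
theorem transition_cylinder_toolkit (L : ℕ) [NeZero L] (β' : ℝ)
    (κ : ℝ≥0 → Kernel (GaugeConfig 3 L (Matrix.specialUnitaryGroup (Fin 2) ℂ))
      (GaugeConfig 3 L (Matrix.specialUnitaryGroup (Fin 2) ℂ))) [∀ t, IsMarkovKernel (κ t)]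
    (hreal : ∀ (t : ℝ≥0) (x : GaugeConfig 3 L (Matrix.specialUnitaryGroup (Fin 2) ℂ))
        (Ω : Type) [MeasurableSpace Ω] (P : Measure Ω) [IsProbabilityMeasure P]
        (W : ℝ≥0 → Ω → (Edge 3 L × NoiseIdx 2 → ℝ)) (hW : IsFlatBrownian W P)
        (U : ℝ≥0 → Ω → GaugeConfig 3 L (Matrix.specialUnitaryGroup (Fin 2) ℂ)),
        (∀ ω, U 0 ω = x) →
        (latticeLangevinDynamics (fundamentalLatticeRep 2) β').IsSolution (fundamentalRep (Fin 2))
          hW.natFiltration P W U →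
        κ t x = P.map (U t))
    {q : (Edge 3 L × Fin 2 × Fin 2 × Bool → ℝ) → ℝ} (hq : ContDiff ℝ 3 q) (hqc : HasCompactSupport q) :
    let coords : GaugeConfig 3 L (Matrix.specialUnitaryGroup (Fin 2) ℂ) → (Edge 3 L × Fin 2 × Fin 2 × Bool → ℝ) :=
      fun V q => (fun z : ℂ => if q.2.2.2 then z.im else z.re)
        ((fundamentalRep (Fin 2) (V q.1) : Matrix (Fin 2) (Fin 2) ℂ) q.2.1 q.2.2.1)
    let gen : ((Edge 3 L × Fin 2 × Fin 2 × Bool → ℝ) → ℝ) → GaugeConfig 3 L (Matrix.specialUnitaryGroup (Fin 2) ℂ) → ℝ :=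
      fun h V =>
      (∑ i : Edge 3 L × Fin 2 × Fin 2 × Bool, fderiv ℝ h (coords V) (Pi.single i 1) *
          (fun z : ℂ => if i.2.2.2 then z.im else z.re)
            ((latticeLangevinDynamics (fundamentalLatticeRep 2) β').drift
              (matrixConfig (fundamentalRep (Fin 2)) V) i.1 i.2.1 i.2.2.1) +
      1 / 2 * ∑ i : Edge 3 L × Fin 2 × Fin 2 × Bool, ∑ j : Edge 3 L × Fin 2 × Fin 2 × Bool,
        fderiv ℝ (fun z => fderiv ℝ h z (Pi.single i 1)) (coords V) (Pi.single j 1) *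
          ∑ n : Edge 3 L × NoiseIdx 2,
            (if n.1 = i.1 then (fun z : ℂ => if i.2.2.2 then z.im else z.re)
              ((latticeLangevinDynamics (fundamentalLatticeRep 2) β').noise
                (matrixConfig (fundamentalRep (Fin 2)) V) i.1 n.2 i.2.1 i.2.2.1) else 0) *
            (if n.1 = j.1 then (fun z : ℂ => if j.2.2.2 then z.im else z.re)
              ((latticeLangevinDynamics (fundamentalLatticeRep 2) β').noise
                (matrixConfig (fundamentalRep (Fin 2)) V) j.1 n.2 j.2.1 j.2.2.1) else 0))
    ∃ M : ℝ, (∀ x, |q (coords x)| ≤ M) ∧ (∀ x, |gen q x| ≤ M) ∧ Continuous (gen q) ∧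
      (∀ (τ : ℝ) x, |(∫ y, q (coords y) ∂(κ (τ : ℝ).toNNReal x))| ≤ M) ∧ (∀ (τ : ℝ) x, |(∫ y, gen q y ∂(κ (τ : ℝ).toNNReal x))| ≤ M) ∧
      (∀ τ : ℝ, Continuous fun x => (∫ y, q (coords y) ∂(κ (τ : ℝ).toNNReal x))) ∧ (∀ τ : ℝ, Continuous fun x => (∫ y, gen q y ∂(κ (τ : ℝ).toNNReal x))) ∧
      (∀ x, Continuous fun τ : ℝ => (∫ y, q (coords y) ∂(κ (τ : ℝ).toNNReal x))) ∧ (∀ x, Continuous fun τ : ℝ => (∫ y, gen q y ∂(κ (τ : ℝ).toNNReal x))) ∧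
      (∀ x (τ : ℝ), 0 < τ → HasDerivAt (fun σ : ℝ => (∫ y, q (coords y) ∂(κ (σ : ℝ).toNNReal x))) (∫ y, gen q y ∂(κ (τ : ℝ).toNNReal x)) τ) ∧
      (∀ τ : ℝ, ∫ x, (∫ y, q (coords y) ∂(κ (τ : ℝ).toNNReal x)) ∂(wilsonMeasure (d := 3) (L := L) (fundamentalRep (Fin 2)) β') = ∫ x, q (coords x) ∂(wilsonMeasure (d := 3) (L := L) (fundamentalRep (Fin 2)) β')) ∧
      (∀ τ : ℝ, ∫ x, (∫ y, gen q y ∂(κ (τ : ℝ).toNNReal x)) ∂(wilsonMeasure (d := 3) (L := L) (fundamentalRep (Fin 2)) β') = 0) := by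
  intro coords gen
  classical
  haveI := secondCountableTopology_su2
  haveI := borelSpace_config L
  have hco : Continuous coords := continuous_coords (L := L)
  have hFc : Continuous fun V => q (coords V) := hq.continuous.comp hco
  obtain ⟨Mf, hMf⟩ : ∃ M, ∀ V, |q (coords V)| ≤ M := by
    obtain ⟨M, hM⟩ := isCompact_univ.exists_bound_of_continuousOn hFc.continuousOn
    exact ⟨M, fun V => by simpa [Real.norm_eq_abs] using hM V (Set.mem_univ V)⟩
  obtain ⟨genf, hgenf⟩ : ∃ genf : (GaugeConfig 3 L (Matrix.specialUnitaryGroup (Fin 2) ℂ)) → ℝ, genf = gen q := ⟨_, rfl⟩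
  have hgenfc : Continuous genf := by rw [hgenf]; exact continuous_generator (L := L) β' (hq.of_le (by norm_num))
  obtain ⟨Mg, hMg⟩ : ∃ M, ∀ V, |genf V| ≤ M := by
    obtain ⟨M, hM⟩ := isCompact_univ.exists_bound_of_continuousOn hgenfc.continuousOn
    exact ⟨M, fun V => by simpa [Real.norm_eq_abs] using hM V (Set.mem_univ V)⟩
  have hgen0 : ∫ x, genf x ∂(wilsonMeasure (d := 3) (L := L) (fundamentalRep (Fin 2)) β') = 0 := by rw [hgenf]; exact integral_generator_wilson_eq_zero L β' hq hqc
  rw [← hgenf]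
  refine ⟨max Mf Mg, fun x => (hMf x).trans (le_max_left _ _), fun x => (hMg x).trans (le_max_right _ _), hgenfc,
    fun τ x => ?_, fun τ x => ?_, fun τ => ?_, fun τ => ?_, fun x => ?_, fun x => ?_, fun x τ hτ => ?_, fun τ => ?_, fun τ => ?_⟩
  · haveI : IsProbabilityMeasure (κ τ.toNNReal x) := IsMarkovKernel.isProbabilityMeasure x
    refine (abs_integral_le_integral_abs).trans ((le_max_left Mf Mg).trans' ?_)
    calc ∫ y, |q (coords y)| ∂(κ τ.toNNReal x) ≤ ∫ _y, Mf ∂(κ τ.toNNReal x) :=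
          integral_mono (integrable_of_continuous_of_compactSpace (continuous_abs.comp hFc) _)
            (integrable_const _) fun y => hMf y
      _ = Mf := by simp
  · haveI : IsProbabilityMeasure (κ τ.toNNReal x) := IsMarkovKernel.isProbabilityMeasure x
    refine (abs_integral_le_integral_abs).trans ((le_max_right Mf Mg).trans' ?_)
    calc ∫ y, |genf y| ∂(κ τ.toNNReal x) ≤ ∫ _y, Mg ∂(κ τ.toNNReal x) :=
          integral_mono (integrable_of_continuous_of_compactSpace (continuous_abs.comp hgenfc) _)
            (integrable_const _) fun y => hMg y
      _ = Mg := by simp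
  · exact continuous_integral_transitionKernel L β' κ hreal τ.toNNReal hFc
  · exact continuous_integral_transitionKernel L β' κ hreal τ.toNNReal hgenfc
  · exact (continuous_transitionKernel_action (L := L) β' κ hreal hFc).comp (continuous_real_toNNReal.prodMk continuous_const)
  · exact (continuous_transitionKernel_action (L := L) β' κ hreal hgenfc).comp (continuous_real_toNNReal.prodMk continuous_const)
  · have hDf := fun {σ : ℝ} (hσ : (0 : ℝ) ≤ σ) => transitionKernel_dynkin (L := L) β' κ hreal hq hqc x hσ
    have ha : Continuous fun r : ℝ => ∫ y, genf y ∂(κ r.toNNReal x) :=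
      (continuous_transitionKernel_action (L := L) β' κ hreal hgenfc).comp (continuous_real_toNNReal.prodMk continuous_const)
    have hder : HasDerivAt (fun σ : ℝ => q (coords x) + ∫ r in (0 : ℝ)..σ, ∫ y, genf y ∂(κ r.toNNReal x))
        (∫ y, genf y ∂(κ τ.toNNReal x)) τ :=
      ((intervalIntegral.integral_hasDerivAt_right (ha.intervalIntegrable _ _)
        (ha.stronglyMeasurableAtFilter _ _) ha.continuousAt)).const_add _
    refine hder.congr_of_eventuallyEq ?_
    filter_upwards [Ioi_mem_nhds hτ] with σ hσ
    have e := hDf (le_of_lt hσ)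
    rw [hgenf]
    exact e
  · exact integral_transitionKernel_integral_eq_wilson (L := L) β' κ hreal τ.toNNReal hFc.measurable ⟨Mf, hMf⟩
  · rw [← hgen0]
    exact integral_transitionKernel_integral_eq_wilson (L := L) β' κ hreal τ.toNNReal hgenfc.measurable ⟨Mg, hMg⟩

/-- ★ **Positivity is preserved**: if `δ ≤ F` on `SU(2)^E` for a continuous `F`, then `δ ≤ κ_t F (x)`. [folklore] -/
theorem le_transition_of_le (L : ℕ) [NeZero L]
    (κ : ℝ≥0 → Kernel (GaugeConfig 3 L (Matrix.specialUnitaryGroup (Fin 2) ℂ)) (GaugeConfig 3 L (Matrix.specialUnitaryGroup (Fin 2) ℂ))) [∀ t, IsMarkovKernel (κ t)]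
    {F : (GaugeConfig 3 L (Matrix.specialUnitaryGroup (Fin 2) ℂ)) → ℝ} (hF : Continuous F) {δ : ℝ} (hδ : ∀ x, δ ≤ F x) (t : ℝ≥0) (x : (GaugeConfig 3 L (Matrix.specialUnitaryGroup (Fin 2) ℂ))) :
    δ ≤ ∫ y, F y ∂(κ t x) := by
  haveI := secondCountableTopology_su2
  haveI := borelSpace_config L
  haveI : IsProbabilityMeasure (κ t x) := IsMarkovKernel.isProbabilityMeasure x
  calc δ = ∫ _y, δ ∂(κ t x) := by simp
    _ ≤ ∫ y, F y ∂(κ t x) := integral_mono (integrable_const _) (integrable_of_continuous_of_compactSpace hF _) fun y => hδ y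

/-! ## §2. De Bruijn: the time-derivative of the entropy -/

/-- ★★ **De Bruijn's identity for the SZZ semigroup at a fixed cut-off.**  For a positive `C³` compactly supported cylinder density
`Q = q∘coords` and any realising kernel family: `τ ↦ ∫ κ_τQ·log κ_τQ dμ_(β')` is continuous on `ℝ` (time read through `toNNReal`) and
for `τ > 0` has derivative `∫ κ_τ(𝓛q)·log κ_τQ dμ_(β')` (the term `∫ κ_τ(𝓛q) dμ` vanishes by invariance).
[cite: BakryGentilLedoux2014, Prop. 5.7.3] -/
theorem entropy_transition_hasDerivAt (L : ℕ) [NeZero L] (β' : ℝ)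
    (κ : ℝ≥0 → Kernel (GaugeConfig 3 L (Matrix.specialUnitaryGroup (Fin 2) ℂ))
      (GaugeConfig 3 L (Matrix.specialUnitaryGroup (Fin 2) ℂ))) [∀ t, IsMarkovKernel (κ t)]
    (hreal : ∀ (t : ℝ≥0) (x : GaugeConfig 3 L (Matrix.specialUnitaryGroup (Fin 2) ℂ))
        (Ω : Type) [MeasurableSpace Ω] (P : Measure Ω) [IsProbabilityMeasure P]
        (W : ℝ≥0 → Ω → (Edge 3 L × NoiseIdx 2 → ℝ)) (hW : IsFlatBrownian W P)
        (U : ℝ≥0 → Ω → GaugeConfig 3 L (Matrix.specialUnitaryGroup (Fin 2) ℂ)),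
        (∀ ω, U 0 ω = x) →
        (latticeLangevinDynamics (fundamentalLatticeRep 2) β').IsSolution (fundamentalRep (Fin 2))
          hW.natFiltration P W U →
        κ t x = P.map (U t))
    {q : (Edge 3 L × Fin 2 × Fin 2 × Bool → ℝ) → ℝ} (hq : ContDiff ℝ 3 q) (hqc : HasCompactSupport q) :
    let coords : GaugeConfig 3 L (Matrix.specialUnitaryGroup (Fin 2) ℂ) → (Edge 3 L × Fin 2 × Fin 2 × Bool → ℝ) :=
      fun V q => (fun z : ℂ => if q.2.2.2 then z.im else z.re)
        ((fundamentalRep (Fin 2) (V q.1) : Matrix (Fin 2) (Fin 2) ℂ) q.2.1 q.2.2.1)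
    let gen : ((Edge 3 L × Fin 2 × Fin 2 × Bool → ℝ) → ℝ) → GaugeConfig 3 L (Matrix.specialUnitaryGroup (Fin 2) ℂ) → ℝ :=
      fun h V =>
      (∑ i : Edge 3 L × Fin 2 × Fin 2 × Bool, fderiv ℝ h (coords V) (Pi.single i 1) *
          (fun z : ℂ => if i.2.2.2 then z.im else z.re)
            ((latticeLangevinDynamics (fundamentalLatticeRep 2) β').drift
              (matrixConfig (fundamentalRep (Fin 2)) V) i.1 i.2.1 i.2.2.1) +
      1 / 2 * ∑ i : Edge 3 L × Fin 2 × Fin 2 × Bool, ∑ j : Edge 3 L × Fin 2 × Fin 2 × Bool,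
        fderiv ℝ (fun z => fderiv ℝ h z (Pi.single i 1)) (coords V) (Pi.single j 1) *
          ∑ n : Edge 3 L × NoiseIdx 2,
            (if n.1 = i.1 then (fun z : ℂ => if i.2.2.2 then z.im else z.re)
              ((latticeLangevinDynamics (fundamentalLatticeRep 2) β').noise
                (matrixConfig (fundamentalRep (Fin 2)) V) i.1 n.2 i.2.1 i.2.2.1) else 0) *
            (if n.1 = j.1 then (fun z : ℂ => if j.2.2.2 then z.im else z.re)
              ((latticeLangevinDynamics (fundamentalLatticeRep 2) β').noise
                (matrixConfig (fundamentalRep (Fin 2)) V) j.1 n.2 j.2.1 j.2.2.1) else 0))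
    (∀ x, 0 < q (coords x)) →
    (Continuous fun τ : ℝ => ∫ x, (∫ y, q (coords y) ∂(κ (τ : ℝ).toNNReal x)) * Real.log (∫ y, q (coords y) ∂(κ (τ : ℝ).toNNReal x)) ∂(wilsonMeasure (d := 3) (L := L) (fundamentalRep (Fin 2)) β')) ∧
    (∀ τ : ℝ, 0 < τ → HasDerivAt (fun σ : ℝ => ∫ x, (∫ y, q (coords y) ∂(κ (σ : ℝ).toNNReal x)) * Real.log (∫ y, q (coords y) ∂(κ (σ : ℝ).toNNReal x)) ∂(wilsonMeasure (d := 3) (L := L) (fundamentalRep (Fin 2)) β'))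
      (∫ x, (∫ y, gen q y ∂(κ (τ : ℝ).toNNReal x)) * Real.log (∫ y, q (coords y) ∂(κ (τ : ℝ).toNNReal x)) ∂(wilsonMeasure (d := 3) (L := L) (fundamentalRep (Fin 2)) β')) τ) := by
  intro coords gen hpos
  classical
  haveI := secondCountableTopology_su2
  haveI := borelSpace_config L
  set μ : Measure (GaugeConfig 3 L (Matrix.specialUnitaryGroup (Fin 2) ℂ)) := (wilsonMeasure (d := 3) (L := L) (fundamentalRep (Fin 2)) β') with hμ
  haveI : IsProbabilityMeasure μ :=
    isProbabilityMeasure_wilsonMeasure (d := 3) (L := L) (fundamentalRep (Fin 2)) (continuous_fundamentalRep (Fin 2)) β'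
  have hco : Continuous coords := continuous_coords (L := L)
  have hQc : Continuous fun V => q (coords V) := hq.continuous.comp hco
  obtain ⟨M, hMq, -, hgenc, hPFb, hPGb, hPFcx, hPGcx, hPFct, hPGct, hPFder, -, hinvG⟩ :=
    transition_cylinder_toolkit L β' κ hreal hq hqc
  obtain ⟨δ, hδ, hQδ⟩ : ∃ δ : ℝ, 0 < δ ∧ ∀ x : (GaugeConfig 3 L (Matrix.specialUnitaryGroup (Fin 2) ℂ)), δ ≤ q (coords x) := by
    obtain ⟨x₀, -, hx₀⟩ := isCompact_univ.exists_isMinOn (Set.univ_nonempty) hQc.continuousOn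
    exact ⟨q (coords x₀), hpos x₀, fun x => hx₀ (Set.mem_univ x)⟩
  obtain ⟨PF, hPF⟩ : ∃ PF : ℝ → (GaugeConfig 3 L (Matrix.specialUnitaryGroup (Fin 2) ℂ)) → ℝ, PF = fun τ x => (∫ y, q (coords y) ∂(κ (τ : ℝ).toNNReal x)) := ⟨_, rfl⟩
  obtain ⟨PG, hPG⟩ : ∃ PG : ℝ → (GaugeConfig 3 L (Matrix.specialUnitaryGroup (Fin 2) ℂ)) → ℝ, PG = fun τ x => (∫ y, gen q y ∂(κ (τ : ℝ).toNNReal x)) := ⟨_, rfl⟩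
  have hPFδ : ∀ τ x, δ ≤ PF τ x := fun τ x => by rw [hPF]; exact le_transition_of_le L κ hQc hQδ _ x
  have hPFpos : ∀ τ x, 0 < PF τ x := fun τ x => hδ.trans_le (hPFδ τ x)
  have hPFM : ∀ τ x, PF τ x ≤ M := fun τ x => by rw [hPF]; exact (le_abs_self _).trans (hPFb τ x)
  have hδM : δ ≤ M := (hPFδ 0 (fun _ => 1)).trans (hPFM 0 _)
  -- `log` is bounded on `[δ, M]`
  set C : ℝ := max |Real.log δ| |Real.log M| with hC
  have hlogb : ∀ τ x, |Real.log (PF τ x)| ≤ C := by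
    intro τ x
    have h1 : Real.log δ ≤ Real.log (PF τ x) := Real.log_le_log hδ (hPFδ τ x)
    have h2 : Real.log (PF τ x) ≤ Real.log M := Real.log_le_log (hPFpos τ x) (hPFM τ x)
    rw [abs_le]
    constructor
    · linarith [neg_abs_le (Real.log δ), le_max_left |Real.log δ| |Real.log M|]
    · linarith [le_abs_self (Real.log M), le_max_right |Real.log δ| |Real.log M|]
  have hPFb' : ∀ τ x, |PF τ x| ≤ M := fun τ x => by rw [hPF]; exact hPFb τ x
  have hPGb' : ∀ τ x, |PG τ x| ≤ M := fun τ x => by rw [hPG]; exact hPGb τ x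
  have hPFcx' : ∀ τ, Continuous fun x => PF τ x := fun τ => by rw [hPF]; exact hPFcx τ
  have hPGcx' : ∀ τ, Continuous fun x => PG τ x := fun τ => by rw [hPG]; exact hPGcx τ
  have hPFct' : ∀ x, Continuous fun τ => PF τ x := fun x => by rw [hPF]; exact hPFct x
  have hPFder' : ∀ x {τ : ℝ}, 0 < τ → HasDerivAt (fun σ => PF σ x) (PG τ x) τ := fun x τ hτ => by
    rw [hPF, hPG]; exact hPFder x τ hτ
  have hlogcx : ∀ τ, Continuous fun x => Real.log (PF τ x) := fun τ =>
    (hPFcx' τ).log fun x => (hPFpos τ x).ne'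
  have hlogct : ∀ x, Continuous fun τ => Real.log (PF τ x) := fun x =>
    (hPFct' x).log fun τ => (hPFpos τ x).ne'
  -- restate the goal through `PF`, `PG`
  have hgoal1 : (fun τ : ℝ => ∫ x, (∫ y, q (coords y) ∂(κ (τ : ℝ).toNNReal x)) * Real.log (∫ y, q (coords y) ∂(κ (τ : ℝ).toNNReal x)) ∂μ) = fun τ => ∫ x, PF τ x * Real.log (PF τ x) ∂μ := by
    rw [hPF]
  have hgoal2 : ∀ τ : ℝ, (∫ x, (∫ y, gen q y ∂(κ (τ : ℝ).toNNReal x)) * Real.log (∫ y, q (coords y) ∂(κ (τ : ℝ).toNNReal x)) ∂μ) = ∫ x, PG τ x * Real.log (PF τ x) ∂μ := by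
    intro τ; rw [hPF, hPG]
  rw [hgoal1]
  simp_rw [hgoal2]
  constructor
  · refine continuous_of_dominated (bound := fun _ => M * C) (fun τ => ?_) (fun τ => ?_) (integrable_const _) (ae_of_all _ fun x => ?_)
    · exact ((hPFcx' τ).mul (hlogcx τ)).aestronglyMeasurable
    · refine ae_of_all _ fun x => ?_
      rw [Real.norm_eq_abs, abs_mul]
      exact mul_le_mul (hPFb' τ x) (hlogb τ x) (abs_nonneg _) ((abs_nonneg _).trans (hPFb' τ x))
    · exact (hPFct' x).mul (hlogct x)
  · intro τ hτ
    have hs : Ioi (τ / 2) ∈ 𝓝 τ := Ioi_mem_nhds (by linarith)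
    have hD := (hasDerivAt_integral_of_dominated_loc_of_deriv_le (μ := μ) (x₀ := τ)
      (F := fun σ x => PF σ x * Real.log (PF σ x)) (F' := fun σ x => PG σ x * Real.log (PF σ x) + PG σ x)
      (bound := fun _ => M * C + M) hs ?_ ?_ ?_ ?_ (integrable_const _) ?_).2
    · have hsplit : ∫ x, (PG τ x * Real.log (PF τ x) + PG τ x) ∂μ = ∫ x, PG τ x * Real.log (PF τ x) ∂μ := by
        have hi1 : Integrable (fun x => PG τ x * Real.log (PF τ x)) μ :=
          integrable_of_continuous_of_compactSpace ((hPGcx' τ).mul (hlogcx τ)) _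
        have hi2 : Integrable (fun x => PG τ x) μ := integrable_of_continuous_of_compactSpace (hPGcx' τ) _
        have h0 : ∫ x, PG τ x ∂μ = 0 := by rw [hPG]; exact hinvG τ
        rw [integral_add hi1 hi2, h0, add_zero]
      rw [hsplit] at hD
      exact hD
    · exact Filter.Eventually.of_forall fun σ => ((hPFcx' σ).mul (hlogcx σ)).aestronglyMeasurable
    · exact integrable_of_continuous_of_compactSpace ((hPFcx' τ).mul (hlogcx τ)) _
    · exact (((hPGcx' τ).mul (hlogcx τ)).add (hPGcx' τ)).aestronglyMeasurable
    · refine ae_of_all _ fun x σ _ => ?_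
      rw [Real.norm_eq_abs]
      refine (abs_add_le _ _).trans (add_le_add ?_ (hPGb' σ x))
      rw [abs_mul]
      exact mul_le_mul (hPGb' σ x) (hlogb σ x) (abs_nonneg _) ((abs_nonneg _).trans (hPGb' σ x))
    · refine ae_of_all _ fun x σ hσ => ?_
      have hσ0 : 0 < σ := lt_trans (by linarith) hσ
      have hne : PF σ x ≠ 0 := (hPFpos σ x).ne'
      have h1 := (hPFder' x hσ0).mul ((hPFder' x hσ0).log hne)
      refine h1.congr_deriv ?_
      field_simp

/-! ## §3. The time-derivative of the Fisher information -/

/-- ★★ **Time-derivative of `τ ↦ ∫ κ_τ(𝓛q)·log κ_τQ dμ_(β')`** (minus the Fisher information).  For a positive `C³` compactly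
supported cylinder density `Q = q∘coords`, a `C³` compactly supported ambient representative `G` of `𝓛q` (`G∘coords = 𝓛q`) and any
realising kernel family: the map is continuous on `ℝ` and for `τ > 0` has derivative
`∫ (κ_τ(𝓛G)·log κ_τQ + (κ_τ𝓛q)²/κ_τQ) dμ_(β')` (`∂_τ κ_τ(𝓛q) = κ_τ(𝓛G)` by Dynkin for `G`). [cite: BakryGentilLedoux2014, Prop. 5.7.3] -/
theorem fisher_transition_hasDerivAt (L : ℕ) [NeZero L] (β' : ℝ)
    (κ : ℝ≥0 → Kernel (GaugeConfig 3 L (Matrix.specialUnitaryGroup (Fin 2) ℂ))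
      (GaugeConfig 3 L (Matrix.specialUnitaryGroup (Fin 2) ℂ))) [∀ t, IsMarkovKernel (κ t)]
    (hreal : ∀ (t : ℝ≥0) (x : GaugeConfig 3 L (Matrix.specialUnitaryGroup (Fin 2) ℂ))
        (Ω : Type) [MeasurableSpace Ω] (P : Measure Ω) [IsProbabilityMeasure P]
        (W : ℝ≥0 → Ω → (Edge 3 L × NoiseIdx 2 → ℝ)) (hW : IsFlatBrownian W P)
        (U : ℝ≥0 → Ω → GaugeConfig 3 L (Matrix.specialUnitaryGroup (Fin 2) ℂ)),
        (∀ ω, U 0 ω = x) →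
        (latticeLangevinDynamics (fundamentalLatticeRep 2) β').IsSolution (fundamentalRep (Fin 2))
          hW.natFiltration P W U →
        κ t x = P.map (U t))
    {q : (Edge 3 L × Fin 2 × Fin 2 × Bool → ℝ) → ℝ} (hq : ContDiff ℝ 3 q) (hqc : HasCompactSupport q)
    {G : (Edge 3 L × Fin 2 × Fin 2 × Bool → ℝ) → ℝ} (hG : ContDiff ℝ 3 G) (hGc : HasCompactSupport G) :
    let coords : GaugeConfig 3 L (Matrix.specialUnitaryGroup (Fin 2) ℂ) → (Edge 3 L × Fin 2 × Fin 2 × Bool → ℝ) :=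
      fun V q => (fun z : ℂ => if q.2.2.2 then z.im else z.re)
        ((fundamentalRep (Fin 2) (V q.1) : Matrix (Fin 2) (Fin 2) ℂ) q.2.1 q.2.2.1)
    let gen : ((Edge 3 L × Fin 2 × Fin 2 × Bool → ℝ) → ℝ) → GaugeConfig 3 L (Matrix.specialUnitaryGroup (Fin 2) ℂ) → ℝ :=
      fun h V =>
      (∑ i : Edge 3 L × Fin 2 × Fin 2 × Bool, fderiv ℝ h (coords V) (Pi.single i 1) *
          (fun z : ℂ => if i.2.2.2 then z.im else z.re)
            ((latticeLangevinDynamics (fundamentalLatticeRep 2) β').drift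
              (matrixConfig (fundamentalRep (Fin 2)) V) i.1 i.2.1 i.2.2.1) +
      1 / 2 * ∑ i : Edge 3 L × Fin 2 × Fin 2 × Bool, ∑ j : Edge 3 L × Fin 2 × Fin 2 × Bool,
        fderiv ℝ (fun z => fderiv ℝ h z (Pi.single i 1)) (coords V) (Pi.single j 1) *
          ∑ n : Edge 3 L × NoiseIdx 2,
            (if n.1 = i.1 then (fun z : ℂ => if i.2.2.2 then z.im else z.re)
              ((latticeLangevinDynamics (fundamentalLatticeRep 2) β').noise
                (matrixConfig (fundamentalRep (Fin 2)) V) i.1 n.2 i.2.1 i.2.2.1) else 0) *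
            (if n.1 = j.1 then (fun z : ℂ => if j.2.2.2 then z.im else z.re)
              ((latticeLangevinDynamics (fundamentalLatticeRep 2) β').noise
                (matrixConfig (fundamentalRep (Fin 2)) V) j.1 n.2 j.2.1 j.2.2.1) else 0))
    (∀ x, 0 < q (coords x)) → (∀ x, G (coords x) = gen q x) →
    (Continuous fun τ : ℝ => ∫ x, (∫ y, gen q y ∂(κ (τ : ℝ).toNNReal x)) * Real.log (∫ y, q (coords y) ∂(κ (τ : ℝ).toNNReal x)) ∂(wilsonMeasure (d := 3) (L := L) (fundamentalRep (Fin 2)) β')) ∧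
    (∀ τ : ℝ, 0 < τ → HasDerivAt (fun σ : ℝ => ∫ x, (∫ y, gen q y ∂(κ (σ : ℝ).toNNReal x)) * Real.log (∫ y, q (coords y) ∂(κ (σ : ℝ).toNNReal x)) ∂(wilsonMeasure (d := 3) (L := L) (fundamentalRep (Fin 2)) β'))
      (∫ x, ((∫ y, gen G y ∂(κ (τ : ℝ).toNNReal x)) * Real.log (∫ y, q (coords y) ∂(κ (τ : ℝ).toNNReal x)) + (∫ y, gen q y ∂(κ (τ : ℝ).toNNReal x)) ^ 2 / (∫ y, q (coords y) ∂(κ (τ : ℝ).toNNReal x))) ∂(wilsonMeasure (d := 3) (L := L) (fundamentalRep (Fin 2)) β')) τ) := by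
  intro coords gen hpos hGq
  classical
  haveI := secondCountableTopology_su2
  haveI := borelSpace_config L
  set μ : Measure (GaugeConfig 3 L (Matrix.specialUnitaryGroup (Fin 2) ℂ)) := (wilsonMeasure (d := 3) (L := L) (fundamentalRep (Fin 2)) β') with hμ
  haveI : IsProbabilityMeasure μ :=
    isProbabilityMeasure_wilsonMeasure (d := 3) (L := L) (fundamentalRep (Fin 2)) (continuous_fundamentalRep (Fin 2)) β'
  have hco : Continuous coords := continuous_coords (L := L)
  have hQc : Continuous fun V => q (coords V) := hq.continuous.comp hco
  obtain ⟨M, -, -, -, hPFb, hPGb, hPFcx, hPGcx, hPFct, hPGct, hPFder, -, -⟩ :=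
    transition_cylinder_toolkit L β' κ hreal hq hqc
  obtain ⟨M', -, -, -, -, hPHb, -, hPHcx, -, hPHct, hPGder, -, -⟩ :=
    transition_cylinder_toolkit L β' κ hreal hG hGc
  obtain ⟨δ, hδ, hQδ⟩ : ∃ δ : ℝ, 0 < δ ∧ ∀ x : (GaugeConfig 3 L (Matrix.specialUnitaryGroup (Fin 2) ℂ)), δ ≤ q (coords x) := by
    obtain ⟨x₀, -, hx₀⟩ := isCompact_univ.exists_isMinOn (Set.univ_nonempty) hQc.continuousOn
    exact ⟨q (coords x₀), hpos x₀, fun x => hx₀ (Set.mem_univ x)⟩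
  obtain ⟨PF, hPF⟩ : ∃ PF : ℝ → (GaugeConfig 3 L (Matrix.specialUnitaryGroup (Fin 2) ℂ)) → ℝ, PF = fun τ x => (∫ y, q (coords y) ∂(κ (τ : ℝ).toNNReal x)) := ⟨_, rfl⟩
  obtain ⟨PG, hPG⟩ : ∃ PG : ℝ → (GaugeConfig 3 L (Matrix.specialUnitaryGroup (Fin 2) ℂ)) → ℝ, PG = fun τ x => (∫ y, gen q y ∂(κ (τ : ℝ).toNNReal x)) := ⟨_, rfl⟩
  obtain ⟨PH, hPH⟩ : ∃ PH : ℝ → (GaugeConfig 3 L (Matrix.specialUnitaryGroup (Fin 2) ℂ)) → ℝ, PH = fun τ x => (∫ y, gen G y ∂(κ (τ : ℝ).toNNReal x)) := ⟨_, rfl⟩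
  -- `κ_τ(G∘coords) = κ_τ(𝓛q)`
  have hPGG : ∀ (τ : ℝ) x, (∫ y, G (coords y) ∂(κ τ.toNNReal x)) = PG τ x := fun τ x => by
    rw [hPG]; exact integral_congr_ae (ae_of_all _ fun y => hGq y)
  have hPFδ : ∀ τ x, δ ≤ PF τ x := fun τ x => by rw [hPF]; exact le_transition_of_le L κ hQc hQδ _ x
  have hPFpos : ∀ τ x, 0 < PF τ x := fun τ x => hδ.trans_le (hPFδ τ x)
  have hPFM : ∀ τ x, PF τ x ≤ M := fun τ x => by rw [hPF]; exact (le_abs_self _).trans (hPFb τ x)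
  set C : ℝ := max |Real.log δ| |Real.log M| with hC
  have hlogb : ∀ τ x, |Real.log (PF τ x)| ≤ C := by
    intro τ x
    have h1 : Real.log δ ≤ Real.log (PF τ x) := Real.log_le_log hδ (hPFδ τ x)
    have h2 : Real.log (PF τ x) ≤ Real.log M := Real.log_le_log (hPFpos τ x) (hPFM τ x)
    rw [abs_le]
    constructor
    · linarith [neg_abs_le (Real.log δ), le_max_left |Real.log δ| |Real.log M|]
    · linarith [le_abs_self (Real.log M), le_max_right |Real.log δ| |Real.log M|]
  have hPGb' : ∀ τ x, |PG τ x| ≤ M := fun τ x => by rw [hPG]; exact hPGb τ x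
  have hPHb' : ∀ τ x, |PH τ x| ≤ M' := fun τ x => by rw [hPH]; exact hPHb τ x
  have hPFcx' : ∀ τ, Continuous fun x => PF τ x := fun τ => by rw [hPF]; exact hPFcx τ
  have hPGcx' : ∀ τ, Continuous fun x => PG τ x := fun τ => by rw [hPG]; exact hPGcx τ
  have hPHcx' : ∀ τ, Continuous fun x => PH τ x := fun τ => by rw [hPH]; exact hPHcx τ
  have hPFct' : ∀ x, Continuous fun τ => PF τ x := fun x => by rw [hPF]; exact hPFct x
  have hPGct' : ∀ x, Continuous fun τ => PG τ x := fun x => by rw [hPG]; exact hPGct x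
  have hPFder' : ∀ x {τ : ℝ}, 0 < τ → HasDerivAt (fun σ => PF σ x) (PG τ x) τ := fun x τ hτ => by
    rw [hPF, hPG]; exact hPFder x τ hτ
  have hPGder' : ∀ x {τ : ℝ}, 0 < τ → HasDerivAt (fun σ => PG σ x) (PH τ x) τ := fun x τ hτ => by
    have h1 := hPGder x τ hτ
    have hfun : (fun σ : ℝ => ∫ y, G (coords y) ∂(κ σ.toNNReal x)) = fun σ => PG σ x := funext fun σ => hPGG σ x
    rw [hfun] at h1
    rw [hPH]
    exact h1
  have hlogcx : ∀ τ, Continuous fun x => Real.log (PF τ x) := fun τ => (hPFcx' τ).log fun x => (hPFpos τ x).ne'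
  have hlogct : ∀ x, Continuous fun τ => Real.log (PF τ x) := fun x => (hPFct' x).log fun τ => (hPFpos τ x).ne'
  have hinvcx : ∀ τ, Continuous fun x => (PF τ x)⁻¹ := fun τ => (hPFcx' τ).inv₀ fun x => (hPFpos τ x).ne'
  -- restate the goal through `PF`, `PG`, `PH`
  have hgoal1 : (fun τ : ℝ => ∫ x, (∫ y, gen q y ∂(κ (τ : ℝ).toNNReal x)) * Real.log (∫ y, q (coords y) ∂(κ (τ : ℝ).toNNReal x)) ∂μ) = fun τ => ∫ x, PG τ x * Real.log (PF τ x) ∂μ := by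
    rw [hPF, hPG]
  have hgoal2 : ∀ τ : ℝ, (∫ x, ((∫ y, gen G y ∂(κ (τ : ℝ).toNNReal x)) * Real.log (∫ y, q (coords y) ∂(κ (τ : ℝ).toNNReal x)) + (∫ y, gen q y ∂(κ (τ : ℝ).toNNReal x)) ^ 2 / (∫ y, q (coords y) ∂(κ (τ : ℝ).toNNReal x))) ∂μ) =
      ∫ x, (PH τ x * Real.log (PF τ x) + PG τ x ^ 2 / PF τ x) ∂μ := by
    intro τ; rw [hPF, hPG, hPH]
  rw [hgoal1]
  simp_rw [hgoal2]
  constructor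
  · refine continuous_of_dominated (bound := fun _ => M * C) (fun τ => ?_) (fun τ => ?_) (integrable_const _) (ae_of_all _ fun x => ?_)
    · exact ((hPGcx' τ).mul (hlogcx τ)).aestronglyMeasurable
    · refine ae_of_all _ fun x => ?_
      rw [Real.norm_eq_abs, abs_mul]
      exact mul_le_mul (hPGb' τ x) (hlogb τ x) (abs_nonneg _) ((abs_nonneg _).trans (hPGb' τ x))
    · exact (hPGct' x).mul (hlogct x)
  · intro τ hτ
    have hs : Ioi (τ / 2) ∈ 𝓝 τ := Ioi_mem_nhds (by linarith)
    refine (hasDerivAt_integral_of_dominated_loc_of_deriv_le (μ := μ) (x₀ := τ)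
      (F := fun σ x => PG σ x * Real.log (PF σ x)) (F' := fun σ x => PH σ x * Real.log (PF σ x) + PG σ x ^ 2 / PF σ x)
      (bound := fun _ => M' * C + M * M * δ⁻¹) hs ?_ ?_ ?_ ?_ (integrable_const _) ?_).2
    · exact Filter.Eventually.of_forall fun σ => ((hPGcx' σ).mul (hlogcx σ)).aestronglyMeasurable
    · exact integrable_of_continuous_of_compactSpace ((hPGcx' τ).mul (hlogcx τ)) _
    · have hc2 : Continuous fun x => PG τ x ^ 2 / PF τ x := by
        simp_rw [div_eq_mul_inv]
        exact ((hPGcx' τ).pow 2).mul (hinvcx τ)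
      exact (((hPHcx' τ).mul (hlogcx τ)).add hc2).aestronglyMeasurable
    · refine ae_of_all _ fun x σ _ => ?_
      rw [Real.norm_eq_abs]
      refine (abs_add_le _ _).trans (add_le_add ?_ ?_)
      · rw [abs_mul]
        exact mul_le_mul (hPHb' σ x) (hlogb σ x) (abs_nonneg _) ((abs_nonneg _).trans (hPHb' σ x))
      · rw [abs_div, abs_of_pos (hPFpos σ x), div_eq_mul_inv, pow_two, abs_mul]
        have hinv : (PF σ x)⁻¹ ≤ δ⁻¹ := by
          rw [inv_le_inv₀ (hPFpos σ x) hδ]; exact hPFδ σ x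
        have hM0 : 0 ≤ M := (abs_nonneg _).trans (hPGb' σ x)
        exact mul_le_mul (mul_le_mul (hPGb' σ x) (hPGb' σ x) (abs_nonneg _) hM0) hinv
          (inv_nonneg.2 (hPFpos σ x).le) (mul_nonneg hM0 hM0)
    · refine ae_of_all _ fun x σ hσ => ?_
      have hσ0 : 0 < σ := lt_trans (by linarith) hσ
      have hne : PF σ x ≠ 0 := (hPFpos σ x).ne'
      have h1 := (hPGder' x hσ0).mul ((hPFder' x hσ0).log hne)
      refine h1.congr_deriv ?_
      field_simp

end Summit.QuantumFields.YangMills.Theorems.ColdStartUniversality
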